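import Literature.MathematicalPhysics.QuantumLattice.HubbardTTPrimeGrandCanonicalDensityCoexistenceInterval
import HarnessLib

/-!
# The magnetisation coexistence interval of the 2D `t–t'` Hubbard model at `(β; μ, h)`: the magnetisations of the grand-canonical
# equilibrium states fill EXACTLY the interval between the one-sided `h`-derivatives of the pressure (metamagnetic lever rule)

Topic `MathematicalPhysics/QuantumLattice` (family `hubbard`; stage S2 (iii) `T > 0`, the `H` axis of the phase map). The FIELD twin of
`HubbardTTPrimeGrandCanonicalDensityCoexistenceInterval` (direction `1` = `−h` of the grand-canonical family, `gcInteractionTT'_update_h`): with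
`s_k = 1/(k+1)`, `P(h') = gcPressureTT'Zeeman β t t' U μ h'` and the magnetisation `m(ω) = e_{spinImbalanceInteraction}(ω) = ρ↑(ω) − ρ↓(ω)` (`β > 0`, `U ≥ 0`):

* `IsVarEquilibrium.magnetisation_quotient_bounds_gcInteractionTT'`: every equilibrium at `(μ,h)` has, for every `k`,
  `(P(h) − P(h − s_k))/s_k ≤ β m(ω) ≤ (P(h + s_k) − P(h))/s_k`;
* **`exists_isVarEquilibrium_gcInteractionTT'_magnetisation_eq_of_quotient_bounds`**: every `m` with these pointwise bounds for all `k` is the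
  magnetisation of an equilibrium state at `(μ, h)`.

HONEST SCOPE: existence/characterisation of infinite-volume equilibrium states; no uniqueness, no certificate value, no phase word, no definition.
Everything PROVED, 0 sorry.

## Mathlib / tree search
REUSED: `IsVarEquilibrium.neg_mul_meanEnergy_mem_Icc_oneSided`, `exists_isVarEquilibrium_neg_mul_meanEnergy_eq_of_mem_Icc` (CoexistenceInterval),
`gcInteractionTT'_update_h`, `varPressure_gcInteractionTT'_eq`; Mathlib `ciSup_le`, `le_ciInf`.

## References
* R. B. Israel, *Convexity in the Theory of Lattice Gases* (1979), Thm. I.2.4, §V.1. [cite: Israel1979, Thm. I.2.4]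
* R. B. Griffiths, J. Math. Phys. 5 (1964) 1215, Appendix. [cite: Griffiths1964, Appendix]
-/

noncomputable section

namespace Literature.MathematicalPhysics.QuantumLattice

open _root_.Filter Set InfVolFermionState ThermodynamicLimit
open scoped _root_.Topology

section Hubbard

variable {β : ℝ} (hβ : 0 < β) (t t' : ℝ) {U : ℝ} (hU : 0 ≤ U) (μ hz : ℝ)
include hβ hU

/-- The directional pressure of the grand-canonical family in direction `1` (shift `δ`) is `P(μ, h − δ)`. [cite: Israel1979, Thm. I.2.4] -/
private theorem varPressure_shift_h_eq (δ : ℝ) :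
    (FermionInteraction.linearFamily (hubbardTTPrimeFermionInteraction t t' U) ![numberInteraction 2, spinImbalanceInteraction 2]
      (![-μ, -hz] + Pi.single 1 δ)).varPressure β 1 = gcPressureTT'Zeeman β t t' U μ (hz - δ) := by
  rw [gcInteractionTT'_update_h, varPressure_gcInteractionTT'_eq hβ.le t t' hU]

omit hβ hU in
/-- At shift `0` it is the grand-canonical interaction itself. [cite: Israel1979, Thm. I.2.4] -/
private theorem linearFamily_base_eq' :
    FermionInteraction.linearFamily (hubbardTTPrimeFermionInteraction t t' U) ![numberInteraction 2, spinImbalanceInteraction 2] ![-μ, -hz] =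
      gcInteractionTT' t t' U μ hz := rfl

/-- **Every equilibrium's magnetisation sits between the one-sided `h`-quotients**: for every equilibrium `ω` at `(β; μ, h)` and every `k`,
`(P(h) − P(h − s_k))/s_k ≤ β m(ω) ≤ (P(h + s_k) − P(h))/s_k`, `s_k = 1/(k+1)`, `m = e_{spinImbalanceInteraction}`. [cite: Griffiths1964, Appendix] -/
theorem IsVarEquilibrium.magnetisation_quotient_bounds_gcInteractionTT' {ω : InfVolFermionState 2}
    (hω : ω.IsVarEquilibrium β (gcInteractionTT' t t' U μ hz) 1) (k : ℕ) :
    (gcPressureTT'Zeeman β t t' U μ hz - gcPressureTT'Zeeman β t t' U μ (hz - 1 / ((k : ℝ) + 1))) / (1 / ((k : ℝ) + 1)) ≤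
        β * ω.meanEnergy (spinImbalanceInteraction 2) 1 ∧
      β * ω.meanEnergy (spinImbalanceInteraction 2) 1 ≤
        (gcPressureTT'Zeeman β t t' U μ (hz + 1 / ((k : ℝ) + 1)) - gcPressureTT'Zeeman β t t' U μ hz) / (1 / ((k : ℝ) + 1)) := by
  have hs : (0 : ℝ) < 1 / ((k : ℝ) + 1) := by positivity
  have hω' : ω.IsVarEquilibrium β (FermionInteraction.linearFamily (hubbardTTPrimeFermionInteraction t t' U)
      ![numberInteraction 2, spinImbalanceInteraction 2] ![-μ, -hz]) 1 := by rw [linearFamily_base_eq']; exact hω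
  have h1 := hω'.varPressure_sub_mul_le_update 1 (1 / ((k : ℝ) + 1))
  have h2 := hω'.varPressure_sub_mul_le_update 1 (-(1 / ((k : ℝ) + 1)))
  rw [varPressure_shift_h_eq hβ t t' hU, linearFamily_base_eq', varPressure_gcInteractionTT'_eq hβ.le t t' hU] at h1 h2
  simp only [Matrix.cons_val_one, Matrix.cons_val_zero, sub_neg_eq_add] at h1 h2
  constructor
  · rw [div_le_iff₀ hs]; linarith [h1]
  · rw [le_div_iff₀ hs]; linarith [h2]

/-- **THE MAGNETISATION COEXISTENCE INTERVAL IS FILLED**: if `(P(h) − P(h − s_k))/s_k ≤ βm ≤ (P(h + s_k) − P(h))/s_k` for every `k`, then some variational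
equilibrium state at `(β; t,t',U; μ, h)` has magnetisation EXACTLY `m` (`β > 0`, `U ≥ 0`); with the previous theorem the magnetisations of the
equilibria at `(μ,h)` form exactly this interval. [cite: Israel1979, Thm. I.2.4] -/
theorem exists_isVarEquilibrium_gcInteractionTT'_magnetisation_eq_of_quotient_bounds {m : ℝ}
    (hlo : ∀ k : ℕ, (gcPressureTT'Zeeman β t t' U μ hz - gcPressureTT'Zeeman β t t' U μ (hz - 1 / ((k : ℝ) + 1))) / (1 / ((k : ℝ) + 1)) ≤ β * m)
    (hhi : ∀ k : ℕ, β * m ≤ (gcPressureTT'Zeeman β t t' U μ (hz + 1 / ((k : ℝ) + 1)) - gcPressureTT'Zeeman β t t' U μ hz) / (1 / ((k : ℝ) + 1))) :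
    ∃ ω : InfVolFermionState 2, ω.IsVarEquilibrium β (gcInteractionTT' t t' U μ hz) 1 ∧ ω.meanEnergy (spinImbalanceInteraction 2) 1 = m := by
  set Ψ₀ := hubbardTTPrimeFermionInteraction t t' U
  set Ψv : Fin 2 → FermionInteraction 2 := ![numberInteraction 2, spinImbalanceInteraction 2]
  set θ : Fin 2 → ℝ := ![-μ, -hz]
  have hs : ∀ k : ℕ, (0 : ℝ) < 1 / ((k : ℝ) + 1) := fun k => by positivity
  have hQ : ∀ k : ℕ, ((FermionInteraction.linearFamily Ψ₀ Ψv (θ + Pi.single 1 (1 / ((k : ℝ) + 1)))).varPressure β 1 -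
      (FermionInteraction.linearFamily Ψ₀ Ψv θ).varPressure β 1) / (1 / ((k : ℝ) + 1)) =
      (gcPressureTT'Zeeman β t t' U μ (hz - 1 / ((k : ℝ) + 1)) - gcPressureTT'Zeeman β t t' U μ hz) / (1 / ((k : ℝ) + 1)) := by
    intro k
    rw [varPressure_shift_h_eq hβ t t' hU, linearFamily_base_eq', varPressure_gcInteractionTT'_eq hβ.le t t' hU]
  have hP : ∀ k : ℕ, ((FermionInteraction.linearFamily Ψ₀ Ψv θ).varPressure β 1 -
      (FermionInteraction.linearFamily Ψ₀ Ψv (θ + Pi.single 1 (-(1 / ((k : ℝ) + 1))))).varPressure β 1) / (1 / ((k : ℝ) + 1)) =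
      (gcPressureTT'Zeeman β t t' U μ hz - gcPressureTT'Zeeman β t t' U μ (hz + 1 / ((k : ℝ) + 1))) / (1 / ((k : ℝ) + 1)) := by
    intro k
    rw [varPressure_shift_h_eq hβ t t' hU, linearFamily_base_eq', varPressure_gcInteractionTT'_eq hβ.le t t' hU, sub_neg_eq_add]
  have hlo' : (⨆ k : ℕ, ((FermionInteraction.linearFamily Ψ₀ Ψv θ).varPressure β 1 -
      (FermionInteraction.linearFamily Ψ₀ Ψv (θ + Pi.single 1 (-(1 / ((k : ℝ) + 1))))).varPressure β 1) / (1 / ((k : ℝ) + 1))) ≤ -(β * m) := by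
    refine ciSup_le fun k => ?_
    rw [hP k, div_le_iff₀ (hs k)]
    have h := hhi k
    rw [le_div_iff₀ (hs k)] at h
    linarith
  have hhi' : -(β * m) ≤ ⨅ k : ℕ, ((FermionInteraction.linearFamily Ψ₀ Ψv (θ + Pi.single 1 (1 / ((k : ℝ) + 1)))).varPressure β 1 -
      (FermionInteraction.linearFamily Ψ₀ Ψv θ).varPressure β 1) / (1 / ((k : ℝ) + 1)) := by
    refine le_ciInf fun k => ?_
    rw [hQ k, le_div_iff₀ (hs k)]
    have h := hlo k
    rw [div_le_iff₀ (hs k)] at h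
    linarith
  obtain ⟨ω, hω, he⟩ := exists_isVarEquilibrium_neg_mul_meanEnergy_eq_of_mem_Icc β Ψ₀ Ψv 1 θ 1 (by norm_num : 0 < 2) hlo' hhi'
  refine ⟨ω, by rw [← linearFamily_base_eq']; exact hω, ?_⟩
  have : β * ω.meanEnergy (spinImbalanceInteraction 2) 1 = β * m := by
    have h2 : Ψv 1 = spinImbalanceInteraction 2 := rfl
    rw [h2] at he
    linarith
  exact mul_left_cancel₀ hβ.ne' this

end Hubbard

end Literature.MathematicalPhysics.QuantumLattice
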